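import Summits.ResolutionOfSingularities.ResolutionOfSingularities.Theorems.FrobeniusLadderFInjectiveMacaulayficationTowerPersistenceKit
import HarnessLib

/-!
# THE GLOBAL RECURRENCE RECEIVER — floors recurring up to ISOMORPHISM kill a tower (for recipes that are intrinsic but NOT local: top-stratum centres)
# (crux `FInjectiveMacaulayfication` stmt-ResolutionOfSingularities-15315, chain w45a; res-L1-w45a-lead-1 g9; continues `…TowerPersistenceKit` (p635381))

[OURS · L1 W4.5a] Support file (`--supports stmt-ResolutionOfSingularities-15315 --as helper`); NOT a statement of any manuscript; def-free, fact-free, UNCONDITIONAL; generic.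
AI-written (AI review is weaker than expert review).

WHY. `…TowerPersistenceKit` receives ONE-CHART certificates for recipes that are LOCAL along open immersions (`hloc : (c S).comap j = c U`): the reduced-closure recipes
`singCentre`, `nonFullCentre`, v1 `centre`. The candidate recipes now on the desk after the rad-τ refutation read a GLOBAL datum — «the TOP stratum» of an invariant (res-L1-w45a-idea-1's
I-9 `tjCentre d`: lex-top (dim, generic Tjurina thickness) singular points; Hilbert–Samuel-top variants) — and are NOT local for open immersions (an open `U ⊆ S` missing the top
stratum of `S` has its own, lower top stratum), but they ARE INTRINSIC: they commute with ISOMORPHISMS of schemes (`hiso : (c S').comap e.hom = c S` for `e : S ≅ S'`). For such recipes a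
loop certificate must identify whole FLOORS up to isomorphism («floor n+r ≅ floor n»), which is what the tower engines report anyway (all charts of a floor). This file is that receiver:
* §1 `isBlowup_comp_iso_inv` — a blowing up followed by an isomorphism of the base is a blowing up along the transported centre (`IsBlowup.of_isPullback_of_flat` on a square with two
  isomorphisms, `IsPullback.of_horiz_isIso`).
* §2 ★ `not_exists_tower_of_recurrent_floor₁ (Q hQ) (T c h0 hsucc) (hiso) {ι} (U : ι → Scheme) (hU : each has a non-Q point) (next : ι → ι) (B π) (hπ : ∀ i, IsBlowup (π i) (c (U i)))
  (eB : ∀ i, U (next i) ≅ B i) (S) (hS : ∃ i, Nonempty (S ≅ U i)) : ¬ ∃ n, T n S` — via `FullCentreDescent.not_exists_tower_of_persistent` with `P S := ∃ i, Nonempty (S ≅ U i)`;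
  regularity / FULL versions with `hQ` discharged. Period-r cycles `ι := Fin r`, escalators `ι := ℕ`, as in the kit.
* §3 `hiso` for free from `hloc` (an isomorphism is an open immersion): `comap_iso_of_local` — so the local recipes inherit the global receiver too; and the generic vanishing-ideal-of-closure
  recipe is iso-intrinsic whenever its point-locus is (`comap_vanishingIdeal_closure_of_iso`).
HONEST CAVEATS: no recipe is evaluated; a top-stratum recipe's `hiso` must be proved from ITS definition by whoever types it (the lemma to prove is exactly `hiso`); nothing of the crux is
proved or refuted here.
[folklore assembly; cite: GortzWedhorn2020, Prop. 13.91 (2), (13.19) p. 413] [cite: StacksProject, Tag 080B]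
-/

-- single-problem summit: the doubled namespace component is forced
set_option linter.dupNamespace false

noncomputable section

open AlgebraicGeometry CategoryTheory CategoryTheory.Limits Literature.AlgebraicGeometry.Resolution TopologicalSpace IsLocalRing

namespace Summit.ResolutionOfSingularities.ResolutionOfSingularities.Theorems.FInjectiveMacaulayfication.FullCentreDescent

open Summit.ResolutionOfSingularities.ResolutionOfSingularities.Theorems.FInjectiveMacaulayfication
open SliceableCentre

/-! ## §1 Blowing ups transported along an isomorphism of the base -/

/-- A blowing up `π : B ⟶ X` along `J`, followed by the inverse of an isomorphism `e : S ≅ X`, is a blowing up of `S` along `J.comap e.hom`. [folklore] [cite: GortzWedhorn2020, Prop. 13.91 (2)] -/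
theorem isBlowup_comp_iso_inv {B X S : Scheme.{0}} {π : B ⟶ X} {J : X.IdealSheafData} (hπ : IsBlowup π J) (e : S ≅ X) :
    IsBlowup (π ≫ e.inv) (J.comap e.hom) := by
  have H : IsPullback (𝟙 B) (π ≫ e.inv) π e.hom := IsPullback.of_horiz_isIso ⟨by simp⟩
  exact hπ.of_isPullback_of_flat H

/-! ## §2 Floors recurring up to isomorphism refute every tower -/

/-- **THE RECURRENT-FLOOR LEMMA (certificate form).** `Q` a stalk-local point property (descending along isomorphic stalk maps); `T`/`c` a tower predicate and an INTRINSIC recipe (`hiso`: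
it commutes with isomorphisms); charts/floors `U i` each with a non-`Q` point, one blowing up `π i : B i → U i` along `c (U i)` each, and isomorphisms `U (next i) ≅ B i`. Then no scheme
isomorphic to some `U i` has a tower of any height ending `Q` everywhere. [folklore assembly; OURS] -/
theorem not_exists_tower_of_recurrent_floor₁ (Q : (S : Scheme.{0}) → S → Prop)
    (hQ : ∀ {X Y : Scheme.{0}} (π : X ⟶ Y) (x : X) [IsIso (π.stalkMap x)], Q Y (π.base x) → Q X x)
    (T : ℕ → Scheme.{0} → Prop) (c : (S : Scheme.{0}) → S.IdealSheafData)
    (h0 : ∀ (S : Scheme.{0}), T 0 S → ∀ s : S, Q S s)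
    (hsucc : ∀ (n : ℕ) (S : Scheme.{0}), T (n + 1) S → ∀ (S₁ : Scheme.{0}) (g : S₁ ⟶ S), IsBlowup g (c S) → T n S₁)
    (hiso : ∀ {S S' : Scheme.{0}} (e : S ≅ S'), (c S').comap e.hom = c S)
    {ι : Type} (U : ι → Scheme.{0}) (hU : ∀ i, ∃ u : U i, ¬ Q (U i) u) (next : ι → ι)
    (B : ι → Scheme.{0}) (π : ∀ i, B i ⟶ U i) (hπ : ∀ i, IsBlowup (π i) (c (U i))) (eB : ∀ i, U (next i) ≅ B i)
    (S : Scheme.{0}) (hS : ∃ i, Nonempty (S ≅ U i)) : ¬ ∃ n : ℕ, T n S := by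
  refine not_exists_tower_of_persistent Q T c h0 hsucc (fun S => ∃ i, Nonempty (S ≅ U i)) ?_ ?_ S hS
  · rintro S' ⟨i, ⟨e⟩⟩
    obtain ⟨u, hu⟩ := hU i
    refine ⟨e.inv.base u, fun h => hu ?_⟩
    exact hQ e.inv u h
  · rintro S' ⟨i, ⟨e⟩⟩
    -- the certified blowing up of `U i`, transported to `S'` along `e`, is a blowing up of `S'` along `c S'`
    have hb : IsBlowup (π i ≫ e.inv) (c S') := by
      have h := isBlowup_comp_iso_inv (hπ i) e
      rwa [hiso e] at h
    exact ⟨B i, π i ≫ e.inv, hb, next i, ⟨(eB i).symm⟩⟩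

/-- **REGULARITY VERSION** (K-RR-a / K-SF-type receivers for intrinsic global recipes; `T`, `c` abstract). [folklore assembly; OURS] -/
theorem not_exists_regularTower_of_recurrent_floor₁ (T : ℕ → Scheme.{0} → Prop) (c : (S : Scheme.{0}) → S.IdealSheafData)
    (h0 : ∀ (S : Scheme.{0}), T 0 S → ∀ s : S, s ∈ Scheme.regularLocus S)
    (hsucc : ∀ (n : ℕ) (S : Scheme.{0}), T (n + 1) S → ∀ (S₁ : Scheme.{0}) (g : S₁ ⟶ S), IsBlowup g (c S) → T n S₁)
    (hiso : ∀ {S S' : Scheme.{0}} (e : S ≅ S'), (c S').comap e.hom = c S)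
    {ι : Type} (U : ι → Scheme.{0}) (hU : ∀ i, ∃ u : U i, u ∉ Scheme.regularLocus (U i)) (next : ι → ι)
    (B : ι → Scheme.{0}) (π : ∀ i, B i ⟶ U i) (hπ : ∀ i, IsBlowup (π i) (c (U i))) (eB : ∀ i, U (next i) ≅ B i)
    (S : Scheme.{0}) (hS : ∃ i, Nonempty (S ≅ U i)) : ¬ ∃ n : ℕ, T n S :=
  not_exists_tower_of_recurrent_floor₁ (fun S s => s ∈ Scheme.regularLocus S) (fun π x _ h => mem_regularLocus_descends π x h)
    T c h0 hsucc hiso U hU next B π hπ eB S hS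

/-- **FULL VERSION** (K-TT-a / K-SF-a receivers for intrinsic global recipes; `T`, `c` abstract). [folklore assembly; OURS] -/
theorem not_exists_fullTower_of_recurrent_floor₁ (p : ℕ) (T : ℕ → Scheme.{0} → Prop) (c : (S : Scheme.{0}) → S.IdealSheafData)
    (h0 : ∀ (S : Scheme.{0}), T 0 S → ∀ s : S, FullCl p (S.presheaf.stalk s))
    (hsucc : ∀ (n : ℕ) (S : Scheme.{0}), T (n + 1) S → ∀ (S₁ : Scheme.{0}) (g : S₁ ⟶ S), IsBlowup g (c S) → T n S₁)
    (hiso : ∀ {S S' : Scheme.{0}} (e : S ≅ S'), (c S').comap e.hom = c S)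
    {ι : Type} (U : ι → Scheme.{0}) (hU : ∀ i, ∃ u : U i, ¬ FullCl p ((U i).presheaf.stalk u)) (next : ι → ι)
    (B : ι → Scheme.{0}) (π : ∀ i, B i ⟶ U i) (hπ : ∀ i, IsBlowup (π i) (c (U i))) (eB : ∀ i, U (next i) ≅ B i)
    (S : Scheme.{0}) (hS : ∃ i, Nonempty (S ≅ U i)) : ¬ ∃ n : ℕ, T n S :=
  not_exists_tower_of_recurrent_floor₁ (fun S s => FullCl p (S.presheaf.stalk s)) (fun π x _ h => fullCl_descends p π x h)
    T c h0 hsucc hiso U hU next B π hπ eB S hS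

/-! ## §3 Local recipes are intrinsic; reduced-closure recipes with an intrinsic locus are intrinsic -/

/-- A recipe that is local for open immersions commutes with isomorphisms (an isomorphism is an open immersion). [folklore] -/
theorem comap_iso_of_local (c : (S : Scheme.{0}) → S.IdealSheafData)
    (hloc : ∀ {U S : Scheme.{0}} (j : U ⟶ S) [IsOpenImmersion j], (c S).comap j = c U)
    {S S' : Scheme.{0}} (e : S ≅ S') : (c S').comap e.hom = c S :=
  hloc e.hom

/-- The generic reduced-closure recipe `S ↦ vanishingIdeal (closure (L S))` is intrinsic as soon as the point-locus `L` is transported by isomorphisms. [folklore] -/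
theorem comap_vanishingIdeal_closure_of_iso (L : (S : Scheme.{0}) → Set S)
    (hL : ∀ {S S' : Scheme.{0}} (e : S ≅ S'), e.hom.base ⁻¹' L S' = L S)
    {S S' : Scheme.{0}} (e : S ≅ S') :
    (Scheme.IdealSheafData.vanishingIdeal ⟨closure (L S'), isClosed_closure⟩).comap e.hom =
      Scheme.IdealSheafData.vanishingIdeal ⟨closure (L S), isClosed_closure⟩ := by
  rw [comap_vanishingIdeal_of_isOpenImmersion]
  congr 1
  ext1
  rw [Closeds.coe_preimage]
  change e.hom.base ⁻¹' closure (L S') = closure (L S)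
  rw [preimage_closure_of_isOpenImmersion, hL e]

/-- `RegTower.singCentre` (literal form) is intrinsic. [folklore] -/
theorem singCentre_iso {S S' : Scheme.{0}} (e : S ≅ S') :
    (Scheme.IdealSheafData.vanishingIdeal ⟨closure ((Scheme.regularLocus S')ᶜ), isClosed_closure⟩).comap e.hom =
      Scheme.IdealSheafData.vanishingIdeal ⟨closure ((Scheme.regularLocus S)ᶜ), isClosed_closure⟩ :=
  singCentre_local e.hom

end Summit.ResolutionOfSingularities.ResolutionOfSingularities.Theorems.FInjectiveMacaulayfication.FullCentreDescent

end
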